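import Literature.FieldTheory.ReducedFiniteAlgebraPiFields
import Literature.NumberTheory.PAdicHodge.PadicBaseField
import Literature.NumberTheory.PAdicHodge.AxSenTate
import HarnessLib

/-!
# Finitely many reduced (étale) algebras of bounded dimension over a non-archimedean local field of characteristic `0`

Class-level form (Mathlib's `IsNonarchimedeanLocalField K`, `CharZero K`) of
`Literature.FieldTheory.exists_finite_representatives_padic` and of the finiteness of
bounded-degree subextensions of the algebraic closure: the residue characteristic `p`
(`Literature.NumberTheory.PAdicHodge.exists_prime_valuation_lt_one`), the canonical `ℚ_p`-structure
(`LocalField.padicAlgebra`) and the finiteness `[K : ℚ_p] < ∞`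
(`PadicBase.instFiniteDimensional`) are the tree's; the statements mention none of them.
Theorems only. Motivation (hodgecm, CARTAN-FIN road): consumers stated over
`[IsNonarchimedeanLocalField F] [CharZero F]` (e.g. ★ `Rogawski1990/CartanNormClassesFinite`).
[cite: BombieriGubler2006, Prop 4.5.3] [cite: AtiyahMacdonald1969, Thm 8.7]
-/

noncomputable section

open Module

namespace Literature.NumberTheory.LocalFields

universe v

variable (K : Type) [Field K] [ValuativeRel K] [TopologicalSpace K] [IsNonarchimedeanLocalField K]
  [CharZero K]

/-- **`hfin` for a characteristic-zero non-archimedean local field**: the intermediate fields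
`K ⊆ E ⊆ AlgebraicClosure K` of `K`-degree `≤ d` form a finite set.
[cite: BombieriGubler2006, Prop 4.5.3] -/
theorem finite_setOf_intermediateField_algebraicClosure_finrank_le_of_isNonarchimedeanLocalField
    (d : ℕ) :
    {E : IntermediateField K (AlgebraicClosure K) |
      FiniteDimensional K E ∧ finrank K E ≤ d}.Finite := by
  obtain ⟨p, hp, hpv⟩ := Literature.NumberTheory.PAdicHodge.exists_prime_valuation_lt_one (F := K)
  haveI : Fact p.Prime := ⟨hp⟩
  letI : Algebra ℚ_[p] K := Literature.NumberTheory.GaloisRepresentations.LocalField.padicAlgebra K p hpv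
  haveI : FiniteDimensional ℚ_[p] K :=
    Literature.NumberTheory.PAdicHodge.PadicBase.instFiniteDimensional (F := K) (p := p) hpv
  exact Literature.FieldTheory.finite_setOf_intermediateField_algebraicClosure_finrank_le_padic p K d

/-- **Finitely many reduced commutative `K`-algebras of dimension `≤ N` up to `K`-isomorphism**, for
`K` a non-archimedean local field of characteristic `0`: a finite representative family exists.
[cite: BombieriGubler2006, Prop 4.5.3] [cite: AtiyahMacdonald1969, Thm 8.7] -/
theorem exists_finite_representatives_of_isNonarchimedeanLocalField (N : ℕ) :
    ∃ (ι : Type) (_ : Finite ι) (R : ι → Type) (_ : ∀ i, CommRing (R i))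
      (_ : ∀ i, Algebra K (R i)),
      ∀ (A : Type v) [CommRing A] [Algebra K A] [IsReduced A] [FiniteDimensional K A],
        finrank K A ≤ N → ∃ i, Nonempty (A ≃ₐ[K] R i) := by
  obtain ⟨p, hp, hpv⟩ := Literature.NumberTheory.PAdicHodge.exists_prime_valuation_lt_one (F := K)
  haveI : Fact p.Prime := ⟨hp⟩
  letI : Algebra ℚ_[p] K := Literature.NumberTheory.GaloisRepresentations.LocalField.padicAlgebra K p hpv
  haveI : FiniteDimensional ℚ_[p] K :=
    Literature.NumberTheory.PAdicHodge.PadicBase.instFiniteDimensional (F := K) (p := p) hpv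
  exact Literature.FieldTheory.exists_finite_representatives_padic p K N

/-- The same over a FINITE EXTENSION `L` of the local field `K` (e.g. a quadratic `L ⊇ K`): the
composite `ℚ_p`-structure is finite by the tower law.
[cite: BombieriGubler2006, Prop 4.5.3] [cite: AtiyahMacdonald1969, Thm 8.7] -/
theorem exists_finite_representatives_of_finite_isNonarchimedeanLocalField (L : Type) [Field L]
    [Algebra K L] [FiniteDimensional K L] (N : ℕ) :
    ∃ (ι : Type) (_ : Finite ι) (R : ι → Type) (_ : ∀ i, CommRing (R i))
      (_ : ∀ i, Algebra L (R i)),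
      ∀ (A : Type v) [CommRing A] [Algebra L A] [IsReduced A] [FiniteDimensional L A],
        finrank L A ≤ N → ∃ i, Nonempty (A ≃ₐ[L] R i) := by
  obtain ⟨p, hp, hpv⟩ := Literature.NumberTheory.PAdicHodge.exists_prime_valuation_lt_one (F := K)
  haveI : Fact p.Prime := ⟨hp⟩
  letI : Algebra ℚ_[p] K := Literature.NumberTheory.GaloisRepresentations.LocalField.padicAlgebra K p hpv
  haveI : FiniteDimensional ℚ_[p] K :=
    Literature.NumberTheory.PAdicHodge.PadicBase.instFiniteDimensional (F := K) (p := p) hpv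
  letI : Algebra ℚ_[p] L := ((algebraMap K L).comp (algebraMap ℚ_[p] K)).toAlgebra
  haveI : IsScalarTower ℚ_[p] K L := IsScalarTower.of_algebraMap_eq fun _ => rfl
  haveI : FiniteDimensional ℚ_[p] L := Module.Finite.trans K L
  exact Literature.FieldTheory.exists_finite_representatives_padic p L N

/-- `hfin` over a finite extension `L` of the local field `K`.
[cite: BombieriGubler2006, Prop 4.5.3] -/
theorem finite_setOf_intermediateField_algebraicClosure_finrank_le_of_finite_isNonarchimedeanLocalField
    (L : Type) [Field L] [Algebra K L] [FiniteDimensional K L] (d : ℕ) :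
    {E : IntermediateField L (AlgebraicClosure L) |
      FiniteDimensional L E ∧ finrank L E ≤ d}.Finite := by
  obtain ⟨p, hp, hpv⟩ := Literature.NumberTheory.PAdicHodge.exists_prime_valuation_lt_one (F := K)
  haveI : Fact p.Prime := ⟨hp⟩
  letI : Algebra ℚ_[p] K := Literature.NumberTheory.GaloisRepresentations.LocalField.padicAlgebra K p hpv
  haveI : FiniteDimensional ℚ_[p] K :=
    Literature.NumberTheory.PAdicHodge.PadicBase.instFiniteDimensional (F := K) (p := p) hpv
  letI : Algebra ℚ_[p] L := ((algebraMap K L).comp (algebraMap ℚ_[p] K)).toAlgebra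
  haveI : IsScalarTower ℚ_[p] K L := IsScalarTower.of_algebraMap_eq fun _ => rfl
  haveI : FiniteDimensional ℚ_[p] L := Module.Finite.trans K L
  exact Literature.FieldTheory.finite_setOf_intermediateField_algebraicClosure_finrank_le_padic p L d

end Literature.NumberTheory.LocalFields

end
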